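import Literature.Geometry.Kaehler.ComplexTorusMaps
import Literature.NumberTheory.Adeles.FiniteAdeleLatticeOfGL
import Literature.AlgebraicGeometry.Motives.AbelianVariety
import HarnessLib

/-!
# Torsion and kernel of the rational torsion parametrisation `u_γ : ℚ^ι → G` of a group uniformised by
# a complex torus, `u_γ(v) = φ(π(γ⁻¹ v))` ([Milne, ISV] §6 Thm. 6.11, (63); [Shimura 1998] §17.1, §18.4 (18.4a), §18.6)

Topic `AlgebraicGeometry/ModuliOfAbelianVarieties`; namespace `Literature.AlgebraicGeometry.ModuliOfAbelianVarieties`.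
THEOREMS ONLY (no definition, no named fact, no instance, no `sorry`; net Literature debt **0**).  Cell hodgecm-mathlib
(D-0151), #60 road / Mumford line: the GENERIC CORE of the census item M3a-γ `stub_markingTorsion` (A-p06 CENSUS-M3a
e159c28d §4 row «torsion of `B`», GAP (L1); §5), DEF-FREE so that the next shift's `SiegelAdelicMarking` (B-typ04 T1′ v5
`SiegelModuliInterpretation` draft, §1: fields `Ψ`, `toFun`, `toFun_add`, `γ`, and `r v := toFun (proj Ψ (γ⁻¹ v))`) closes its
torsion stub over these lemmas by `rfl` (the parametrisation below is T1′'s `SiegelAdelicMarking.r_def` VERBATIM in the free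
variables `Ψ, φ, γ`) and B-typ04's `isLatticeBasis_iff_latticeOfGL_eq` (`Λ_a = Λ_γ`).

## The mathematics (folklore; the printed anchors)

Let `Ψ : ℝ^ι ≃ E` be a period matrix, `X = E/Ψ(ℤ^ι)` the complex torus (★ `Geometry.Kaehler.ComplexTorus Ψ`, as a group
`(ℝ/ℤ)^ι` with covering map `π = ComplexTorus.proj Ψ : ℝ^ι → X`), `φ : X → G` an (injective, resp. bijective) map into a
multiplicatively written commutative group with `φ(x + y) = φ(x)φ(y)` — the three data fields shared by ★
`ComplexMultiplication.CMTypeUniformization` (`toFun`, `bijective`, `toFun_add`) and the T1′ carrier `SiegelAdelicMarking`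
(`G = A(ℂ)` for a complex abelian variety `A`) — and `γ ∈ GL_ι(ℚ)` a rational basis matrix of a lattice
`Λ_γ = γ ℤ^ι ⊂ ℚ^ι` (★ R60-19 `Adeles.latticeOfGL (map γ)`, `mem_latticeOfGL_map_iff`: `v ∈ Λ_γ ↔ γ⁻¹ v ∈ ℤ^ι`).  The RATIONAL
TORSION PARAMETRISATION is `u(v) = φ(π(γ⁻¹ v))`, `v ∈ ℚ^ι` ([Milne2005ShimuraVarieties] §6 Thm. 6.11 p. 74 and (63) p. 116: the
level structure `η = ū ∘ a` of the triple `(A, s, ηK)` of a point `[x, a]`; [Shimura1998] §18.6 Thm. 18.6 pp. 124–125 «`r` is the restriction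
of `ξ ∘ q` to `K/𝔞`»).  Then:
* §1 (the torus) `π(q) = 0 ↔ q ∈ ℤ^ι` for RATIONAL `q`; `π(q) = π(q′) ↔ q − q′ ∈ ℤ^ι`; every `N`-torsion point of `X`
  (`N ≠ 0`) is `π(q)` with `q ∈ N⁻¹ℤ^ι ⊂ ℚ^ι` ([LangeBirkenhake1992] Prop. 1.1.14 / [Lange2023] §1.1.2 «`X_n ≃ (ℤ/nℤ)^{2g}`»;
  [Shimura1998] §17.1 p. 118 «points of finite order»).
* §2 (the parametrisation) `u` is additive, `u(n·v) = u(v)ⁿ`; KERNEL `u(v) = 1 ↔ v ∈ Λ_γ` (for `φ` injective), `u(v) = u(w) ↔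
  v − w ∈ Λ_γ`; `N·v ∈ Λ_γ ⇒ u(v)^N = 1`; and, for `φ` BIJECTIVE, TORSION IS ONTO: `P^N = 1`, `N ≠ 0` ⇒ `P = u(v)` for some
  `v ∈ N⁻¹Λ_γ` — exactness of `0 → Λ → V → X → 0` read on the rational points, the analogue for the Siegel marking of ★
  `CMTypeUniformization.exists_r_eq_of_mem_torsionPoints` / `mem_torsionPoints_iff_exists_r_eq` (`A[N](ℂ) = r(N⁻¹𝔞/𝔞)`,
  [Shimura1998] §18.4 (18.4a) (≈ p. 123)).
* §3 the `A.torsionPoints ℂ N` spelling for `G = A(ℂ)` (★ `Motives.AbelianVariety.mem_torsionPoints_iff`).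
Consumers: the M3a assembly of the Mumford line (A-p06's route ξ′, STEP ÷M over ★ R60-44
`AbelianVariety.exists_eq_zsmul_and_map_eq_of_map_eq_nsmul`: its `htors` = §2/§3 «torsion onto», its `hker` = §2 «kernel»), and
B-typ04's `SiegelAdelicMarking.r_eq_of_forall_mem` (= the `←` half of `…_eq_one_iff_mem_latticeOfGL` at `γ` with `Λ_a = Λ_γ`).
Nothing printed is asserted as a fact.  HC_CM is proved only modulo the 7 printed citations until rung 0 closes.

## References
* [Milne2005ShimuraVarieties] J. S. Milne, *Introduction to Shimura varieties* (2005), §6 Thm. 6.11 p. 74; §12 (63) p. 116.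
* [Shimura1998] G. Shimura, *Abelian Varieties with Complex Multiplication and Modular Functions* (1998), §17.1 p. 118,
  §18.4 (18.4a) (≈ p. 123), §18.6 Thm. 18.6 pp. 124–125.
* [LangeBirkenhake1992] H. Lange, Ch. Birkenhake, *Complex Abelian Varieties* (1992), §1.1 Prop. 1.1.14.
-/

set_option autoImplicit false

noncomputable section

open Matrix
open Literature.Geometry.Kaehler (ComplexTorus)
open Literature.NumberTheory.Adeles (latticeOfGL mem_latticeOfGL_map_iff)

namespace Literature.AlgebraicGeometry.ModuliOfAbelianVarieties

variable {ι : Type} {E : Type} [NormedAddCommGroup E] [NormedSpace ℂ E] (Ψ : (ι → ℝ) ≃L[ℝ] E)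

/-! ### §1. Rational points of the real torus `(ℝ/ℤ)^ι`: kernel `ℤ^ι`, torsion `N⁻¹ℤ^ι/ℤ^ι` -/

/-- **`π(q) = 0 ↔ q ∈ ℤ^ι`** for a RATIONAL vector `q` (the kernel of the covering map is the lattice, read on `ℚ^ι`).
[cite: LangeBirkenhake1992, §1.1 (the lattice `Λ = Π(ℤ^{2g})`)] -/
theorem complexTorus_proj_ratCast_eq_zero_iff (q : ι → ℚ) :
    ComplexTorus.proj Ψ (fun i => (q i : ℝ)) = 0 ↔ ∀ i, ∃ z : ℤ, (z : ℚ) = q i := by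
  constructor
  · intro h i
    have hi : (((q i : ℚ) : ℝ) : AddCircle (1 : ℝ)) = 0 := by
      rw [← ComplexTorus.proj_apply Ψ (fun i => (q i : ℝ)) i, h]; rfl
    obtain ⟨k, hk⟩ := (AddCircle.coe_eq_zero_iff (1 : ℝ)).1 hi
    refine ⟨k, ?_⟩
    rw [zsmul_eq_mul, mul_one] at hk
    exact_mod_cast hk
  · intro h
    funext i
    obtain ⟨z, hz⟩ := h i
    rw [ComplexTorus.proj_apply, ← hz, Rat.cast_intCast,
      show (0 : ComplexTorus Ψ) i = (0 : AddCircle (1 : ℝ)) from rfl, AddCircle.coe_eq_zero_iff]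
    exact ⟨z, by rw [zsmul_eq_mul, mul_one]⟩

/-- `π` is compatible with subtraction (it is a group homomorphism `ℝ^ι → (ℝ/ℤ)^ι`). [folklore] -/
private theorem complexTorus_proj_sub (x y : ι → ℝ) :
    ComplexTorus.proj Ψ (x - y) = ComplexTorus.proj Ψ x - ComplexTorus.proj Ψ y := by
  funext i
  simp only [ComplexTorus.proj_apply, Pi.sub_apply, AddCircle.coe_sub]
  rfl

/-- `π` is compatible with integer multiples. [folklore] -/
private theorem complexTorus_proj_zsmul (n : ℤ) (x : ι → ℝ) :
    ComplexTorus.proj Ψ (n • x) = n • ComplexTorus.proj Ψ x := by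
  funext i
  simp only [ComplexTorus.proj_apply, Pi.smul_apply, AddCircle.coe_zsmul]
  rfl

/-- `π` is compatible with natural multiples. [folklore] -/
private theorem complexTorus_proj_nsmul (n : ℕ) (x : ι → ℝ) :
    ComplexTorus.proj Ψ (n • x) = n • ComplexTorus.proj Ψ x := by
  funext i
  simp only [ComplexTorus.proj_apply, Pi.smul_apply, AddCircle.coe_nsmul]
  rfl

/-- **`π(q) = π(q′) ↔ q − q′ ∈ ℤ^ι`** for rational `q, q′`. [cite: LangeBirkenhake1992, §1.1] -/
theorem complexTorus_proj_ratCast_eq_proj_ratCast_iff (q q' : ι → ℚ) :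
    ComplexTorus.proj Ψ (fun i => (q i : ℝ)) = ComplexTorus.proj Ψ (fun i => (q' i : ℝ)) ↔
      ∀ i, ∃ z : ℤ, (z : ℚ) = q i - q' i := by
  have h : ((fun i => (q i : ℝ)) - fun i => (q' i : ℝ)) = fun i => ((q - q') i : ℝ) := by
    funext i; simp only [Pi.sub_apply, Rat.cast_sub]
  rw [← sub_eq_zero, ← complexTorus_proj_sub, h, complexTorus_proj_ratCast_eq_zero_iff]
  simp only [Pi.sub_apply]

/-- **The `N`-torsion of the torus is `N⁻¹ℤ^ι/ℤ^ι`**: if `N·t = 0` (`N ≠ 0`) then `t = π(q)` for a rational `q` with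
`N·q ∈ ℤ^ι` («`X_n ≃ (ℤ/nℤ)^{2g}`»). [cite: LangeBirkenhake1992, §1.1 Prop. 1.1.14] [cite: Shimura1998, §17.1 p. 118] -/
theorem complexTorus_exists_ratCast_of_zsmul_eq_zero {N : ℤ} (hN : N ≠ 0) {t : ComplexTorus Ψ} (ht : N • t = 0) :
    ∃ q : ι → ℚ, (∀ i, ∃ z : ℤ, (z : ℚ) = N * q i) ∧ ComplexTorus.proj Ψ (fun i => (q i : ℝ)) = t := by
  -- `t = π(x)`; `π(N x) = N π(x) = 0`, so `N x ∈ ℤ^ι`, i.e. `x = z/N`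
  have hx : ∀ i, ∃ z : ℤ, (z : ℝ) = N * ComplexTorus.lift Ψ t i := by
    intro i
    have h1 : ComplexTorus.proj Ψ (N • ComplexTorus.lift Ψ t) = 0 := by
      rw [complexTorus_proj_zsmul, ComplexTorus.proj_lift, ht]
    have h2 : (((N • ComplexTorus.lift Ψ t) i : ℝ) : AddCircle (1 : ℝ)) = 0 := by
      rw [← ComplexTorus.proj_apply Ψ (N • ComplexTorus.lift Ψ t) i, h1]; rfl
    obtain ⟨k, hk⟩ := (AddCircle.coe_eq_zero_iff (1 : ℝ)).1 h2
    refine ⟨k, ?_⟩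
    rw [zsmul_eq_mul, mul_one] at hk
    rw [hk, Pi.smul_apply, zsmul_eq_mul]
  choose z hz using hx
  have hN' : (N : ℚ) ≠ 0 := Int.cast_ne_zero.mpr hN
  have hNR : (N : ℝ) ≠ 0 := Int.cast_ne_zero.mpr hN
  refine ⟨fun i => (z i : ℚ) / N, fun i => ⟨z i, ?_⟩, ?_⟩
  · rw [mul_div_cancel₀ _ hN']
  · have hq : (fun i => (((z i : ℚ) / N : ℚ) : ℝ)) = ComplexTorus.lift Ψ t := by
      funext i
      rw [Rat.cast_div, Rat.cast_intCast, Rat.cast_intCast, hz i, mul_div_cancel_left₀ _ hNR]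
    rw [hq, ComplexTorus.proj_lift]

/-! ### §2. The rational torsion parametrisation `u(v) = φ(π(γ⁻¹ v))` of a group uniformised by the torus -/

section Parametrisation

variable {G : Type} [CommGroup G] (φ : ComplexTorus Ψ → G)

/-- `φ(0) = 1` for an additive-to-multiplicative `φ`. [folklore] -/
private theorem map_zero_eq_one_of_map_add (hadd : ∀ x y, φ (x + y) = φ x * φ y) : φ 0 = 1 := by
  have h := hadd 0 0
  rw [add_zero] at h
  exact mul_eq_left.mp h.symm

/-- `φ(n • x) = φ(x)ⁿ` for an additive-to-multiplicative `φ`. [folklore] -/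
private theorem map_nsmul_eq_pow_of_map_add (hadd : ∀ x y, φ (x + y) = φ x * φ y) (n : ℕ) (x : ComplexTorus Ψ) :
    φ (n • x) = φ x ^ n := by
  induction n with
  | zero => rw [zero_smul, pow_zero, map_zero_eq_one_of_map_add Ψ φ hadd]
  | succ n ih => rw [succ_nsmul, hadd, ih, pow_succ]

/-- `φ(N • x) = φ(x)^N` (`N : ℤ`) for an additive-to-multiplicative `φ`. [folklore] -/
private theorem map_zsmul_eq_zpow_of_map_add (hadd : ∀ x y, φ (x + y) = φ x * φ y) (N : ℤ) (x : ComplexTorus Ψ) :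
    φ (N • x) = φ x ^ N := by
  have hneg : ∀ y : ComplexTorus Ψ, φ (-y) = (φ y)⁻¹ := by
    intro y
    have h := hadd y (-y)
    rw [add_neg_cancel, map_zero_eq_one_of_map_add Ψ φ hadd] at h
    exact (eq_inv_of_mul_eq_one_right h.symm)
  obtain ⟨n, rfl | rfl⟩ := Int.eq_nat_or_neg N
  · rw [natCast_zsmul, zpow_natCast, map_nsmul_eq_pow_of_map_add Ψ φ hadd]
  · rw [neg_smul, natCast_zsmul, hneg, map_nsmul_eq_pow_of_map_add Ψ φ hadd, _root_.zpow_neg, zpow_natCast]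

/-- `φ(x) = 1 ↔ x = 0` for an injective additive-to-multiplicative `φ`. [folklore] -/
private theorem map_eq_one_iff_of_injective (hφ : Function.Injective φ) (hadd : ∀ x y, φ (x + y) = φ x * φ y)
    (x : ComplexTorus Ψ) : φ x = 1 ↔ x = 0 := by
  rw [← map_zero_eq_one_of_map_add Ψ φ hadd, hφ.eq_iff]

variable [Fintype ι] [DecidableEq ι] (γ : GL ι ℚ)

/-- The lattice coordinates `γ⁻¹ v` of a rational vector are additive in `v`, cast to `ℝ`. [folklore] -/
private theorem ratCast_inv_mulVec_add (v w : ι → ℚ) :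
    (fun i => (((((γ⁻¹ : GL ι ℚ) : Matrix ι ι ℚ) *ᵥ (v + w)) i : ℚ) : ℝ)) =
      (fun i => (((((γ⁻¹ : GL ι ℚ) : Matrix ι ι ℚ) *ᵥ v) i : ℚ) : ℝ)) +
        fun i => (((((γ⁻¹ : GL ι ℚ) : Matrix ι ι ℚ) *ᵥ w) i : ℚ) : ℝ) := by
  funext i
  simp only [Matrix.mulVec_add, Pi.add_apply, Rat.cast_add]

/-- The lattice coordinates commute with integer multiples, cast to `ℝ`. [folklore] -/
private theorem ratCast_inv_mulVec_zsmul (N : ℤ) (v : ι → ℚ) :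
    (fun i => (((((γ⁻¹ : GL ι ℚ) : Matrix ι ι ℚ) *ᵥ (N • v)) i : ℚ) : ℝ)) =
      N • fun i => (((((γ⁻¹ : GL ι ℚ) : Matrix ι ι ℚ) *ᵥ v) i : ℚ) : ℝ) := by
  funext i
  rw [zsmul_eq_mul, show ((N : ι → ℚ) * v) = (N : ℚ) • v from by funext j; simp [Pi.mul_apply, smul_eq_mul],
    Matrix.mulVec_smul, Pi.smul_apply, Pi.smul_apply, smul_eq_mul, Rat.cast_mul, Rat.cast_intCast, zsmul_eq_mul]

/-- **`u` is additive**: `u(v + w) = u(v)·u(w)` (T1′ `SiegelAdelicMarking.r_add`, in the free variables).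
[cite: Milne2005ShimuraVarieties, §6 Thm. 6.11 p. 74] -/
theorem map_proj_inv_mulVec_add (hadd : ∀ x y, φ (x + y) = φ x * φ y) (v w : ι → ℚ) :
    φ (ComplexTorus.proj Ψ fun i => (((((γ⁻¹ : GL ι ℚ) : Matrix ι ι ℚ) *ᵥ (v + w)) i : ℚ) : ℝ)) =
      φ (ComplexTorus.proj Ψ fun i => (((((γ⁻¹ : GL ι ℚ) : Matrix ι ι ℚ) *ᵥ v) i : ℚ) : ℝ)) *
        φ (ComplexTorus.proj Ψ fun i => (((((γ⁻¹ : GL ι ℚ) : Matrix ι ι ℚ) *ᵥ w) i : ℚ) : ℝ)) := by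
  rw [ratCast_inv_mulVec_add, ComplexTorus.proj_add, hadd]

/-- **`u(N·v) = u(v)^N`** (`N : ℤ`). [cite: Milne2005ShimuraVarieties, §6 Thm. 6.11 p. 74] -/
theorem map_proj_inv_mulVec_zsmul (hadd : ∀ x y, φ (x + y) = φ x * φ y) (N : ℤ) (v : ι → ℚ) :
    φ (ComplexTorus.proj Ψ fun i => (((((γ⁻¹ : GL ι ℚ) : Matrix ι ι ℚ) *ᵥ (N • v)) i : ℚ) : ℝ)) =
      φ (ComplexTorus.proj Ψ fun i => (((((γ⁻¹ : GL ι ℚ) : Matrix ι ι ℚ) *ᵥ v) i : ℚ) : ℝ)) ^ N := by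
  rw [ratCast_inv_mulVec_zsmul, complexTorus_proj_zsmul, map_zsmul_eq_zpow_of_map_add Ψ φ hadd]

/-- **`u(N·v) = u(v)^N`** (`N : ℕ`). [cite: Milne2005ShimuraVarieties, §6 Thm. 6.11 p. 74] -/
theorem map_proj_inv_mulVec_nsmul (hadd : ∀ x y, φ (x + y) = φ x * φ y) (N : ℕ) (v : ι → ℚ) :
    φ (ComplexTorus.proj Ψ fun i => (((((γ⁻¹ : GL ι ℚ) : Matrix ι ι ℚ) *ᵥ (N • v)) i : ℚ) : ℝ)) =
      φ (ComplexTorus.proj Ψ fun i => (((((γ⁻¹ : GL ι ℚ) : Matrix ι ι ℚ) *ᵥ v) i : ℚ) : ℝ)) ^ N := by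
  rw [← natCast_zsmul, map_proj_inv_mulVec_zsmul Ψ φ γ hadd, zpow_natCast]

/-- **`π(γ⁻¹ v) = 0 ↔ v ∈ Λ_γ`** (`Λ_γ = γ ℤ^ι`, ★ `Adeles.mem_latticeOfGL_map_iff`). [cite: Milne2005ShimuraVarieties, §4 p. 48] -/
theorem proj_inv_mulVec_eq_zero_iff_mem_latticeOfGL (v : ι → ℚ) :
    ComplexTorus.proj Ψ (fun i => (((((γ⁻¹ : GL ι ℚ) : Matrix ι ι ℚ) *ᵥ v) i : ℚ) : ℝ)) = 0 ↔
      v ∈ latticeOfGL (Matrix.GeneralLinearGroup.map (algebraMap ℚ finAdeleQ) γ) := by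
  rw [complexTorus_proj_ratCast_eq_zero_iff, mem_latticeOfGL_map_iff]

/-- **`v ∈ Λ_γ ⇒ u(v) = 1`** (no injectivity needed). [cite: Milne2005ShimuraVarieties, §6 Thm. 6.11 p. 74] -/
theorem map_proj_inv_mulVec_eq_one_of_mem_latticeOfGL (hadd : ∀ x y, φ (x + y) = φ x * φ y) {v : ι → ℚ}
    (hv : v ∈ latticeOfGL (Matrix.GeneralLinearGroup.map (algebraMap ℚ finAdeleQ) γ)) :
    φ (ComplexTorus.proj Ψ fun i => (((((γ⁻¹ : GL ι ℚ) : Matrix ι ι ℚ) *ᵥ v) i : ℚ) : ℝ)) = 1 := by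
  rw [(proj_inv_mulVec_eq_zero_iff_mem_latticeOfGL Ψ γ v).2 hv, map_zero_eq_one_of_map_add Ψ φ hadd]

/-- **KERNEL: `u(v) = 1 ↔ v ∈ Λ_γ`** for `φ` injective (exactness of `0 → Λ → V → X → 0` on rational points; T1′'s
`r_eq_of_forall_mem` is the `←` half). [cite: Milne2005ShimuraVarieties, §6 Thm. 6.11 p. 74] [cite: Shimura1998, §18.4 (18.4a) (≈ p. 123)] -/
theorem map_proj_inv_mulVec_eq_one_iff_mem_latticeOfGL (hφ : Function.Injective φ)
    (hadd : ∀ x y, φ (x + y) = φ x * φ y) (v : ι → ℚ) :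
    φ (ComplexTorus.proj Ψ fun i => (((((γ⁻¹ : GL ι ℚ) : Matrix ι ι ℚ) *ᵥ v) i : ℚ) : ℝ)) = 1 ↔
      v ∈ latticeOfGL (Matrix.GeneralLinearGroup.map (algebraMap ℚ finAdeleQ) γ) := by
  rw [map_eq_one_iff_of_injective Ψ φ hφ hadd, proj_inv_mulVec_eq_zero_iff_mem_latticeOfGL]

/-- **`u(v) = u(w) ↔ v − w ∈ Λ_γ`** for `φ` injective: `u` is a function on `ℚ^ι/Λ_γ`.
[cite: Milne2005ShimuraVarieties, §6 Thm. 6.11 p. 74] [cite: Shimura1998, §18.6 Thm. 18.6 pp. 124–125] -/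
theorem map_proj_inv_mulVec_eq_iff_sub_mem_latticeOfGL (hφ : Function.Injective φ)
    (hadd : ∀ x y, φ (x + y) = φ x * φ y) (v w : ι → ℚ) :
    φ (ComplexTorus.proj Ψ fun i => (((((γ⁻¹ : GL ι ℚ) : Matrix ι ι ℚ) *ᵥ v) i : ℚ) : ℝ)) =
        φ (ComplexTorus.proj Ψ fun i => (((((γ⁻¹ : GL ι ℚ) : Matrix ι ι ℚ) *ᵥ w) i : ℚ) : ℝ)) ↔
      v - w ∈ latticeOfGL (Matrix.GeneralLinearGroup.map (algebraMap ℚ finAdeleQ) γ) := by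
  rw [← map_proj_inv_mulVec_eq_one_iff_mem_latticeOfGL Ψ φ γ hφ hadd, sub_eq_add_neg,
    map_proj_inv_mulVec_add Ψ φ γ hadd, ← neg_one_zsmul w, map_proj_inv_mulVec_zsmul Ψ φ γ hadd,
    _root_.zpow_neg, zpow_one, mul_inv_eq_one]

/-- **`N·v ∈ Λ_γ ⇒ u(v)^N = 1`**: `u(N⁻¹Λ_γ)` consists of `N`-torsion points.
[cite: Shimura1998, §17.1 p. 118] [cite: Milne2005ShimuraVarieties, §6 Thm. 6.11 p. 74] -/
theorem map_proj_inv_mulVec_zpow_eq_one_of_zsmul_mem (hadd : ∀ x y, φ (x + y) = φ x * φ y) {N : ℤ} {v : ι → ℚ}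
    (hv : N • v ∈ latticeOfGL (Matrix.GeneralLinearGroup.map (algebraMap ℚ finAdeleQ) γ)) :
    φ (ComplexTorus.proj Ψ fun i => (((((γ⁻¹ : GL ι ℚ) : Matrix ι ι ℚ) *ᵥ v) i : ℚ) : ℝ)) ^ N = 1 := by
  rw [← map_proj_inv_mulVec_zsmul Ψ φ γ hadd, map_proj_inv_mulVec_eq_one_of_mem_latticeOfGL Ψ φ γ hadd hv]

/-- **TORSION IS ONTO**: for `φ` bijective and `N ≠ 0`, every `P` with `P^N = 1` is `u(v)` for some `v ∈ N⁻¹Λ_γ` — the points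
of finite order of the uniformised group are the `u(v)`, `v ∈ ℚ^ι` (the analogue of ★
`CMTypeUniformization.exists_r_eq_of_mem_torsionPoints`). [cite: Shimura1998, §17.1 p. 118, §18.4 (18.4a) (≈ p. 123)]
[cite: Milne2005ShimuraVarieties, §6 Thm. 6.11 p. 74] -/
theorem exists_zsmul_mem_latticeOfGL_and_map_proj_inv_mulVec_eq (hφ : Function.Bijective φ)
    (hadd : ∀ x y, φ (x + y) = φ x * φ y) {N : ℤ} (hN : N ≠ 0) {P : G} (hP : P ^ N = 1) :
    ∃ v : ι → ℚ, N • v ∈ latticeOfGL (Matrix.GeneralLinearGroup.map (algebraMap ℚ finAdeleQ) γ) ∧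
      φ (ComplexTorus.proj Ψ fun i => (((((γ⁻¹ : GL ι ℚ) : Matrix ι ι ℚ) *ᵥ v) i : ℚ) : ℝ)) = P := by
  obtain ⟨t, rfl⟩ := hφ.surjective P
  have ht : N • t = 0 := by
    rw [← map_zsmul_eq_zpow_of_map_add Ψ φ hadd, map_eq_one_iff_of_injective Ψ φ hφ.injective hadd] at hP
    exact hP
  obtain ⟨q, hq, hqt⟩ := complexTorus_exists_ratCast_of_zsmul_eq_zero Ψ hN ht
  refine ⟨(γ : Matrix ι ι ℚ) *ᵥ q, ?_, ?_⟩
  · rw [mem_latticeOfGL_map_iff]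
    intro i
    obtain ⟨z, hz⟩ := hq i
    refine ⟨z, ?_⟩
    rw [zsmul_eq_mul, show ((N : ι → ℚ) * ((γ : Matrix ι ι ℚ) *ᵥ q)) = (N : ℚ) • ((γ : Matrix ι ι ℚ) *ᵥ q) from by
        funext j; simp [Pi.mul_apply, smul_eq_mul],
      Matrix.mulVec_smul, Matrix.mulVec_mulVec, ← Units.val_mul, inv_mul_cancel, Units.val_one, Matrix.one_mulVec,
      Pi.smul_apply, smul_eq_mul, hz]
  · rw [← hqt]
    congr 2
    funext i
    rw [Matrix.mulVec_mulVec, ← Units.val_mul, inv_mul_cancel, Units.val_one, Matrix.one_mulVec]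

/-- **`N`-torsion = `u(N⁻¹Λ_γ)`** (iff form, `φ` bijective, `N ≠ 0`). [cite: Shimura1998, §17.1 p. 118, §18.4 (18.4a) (≈ p. 123)] -/
theorem zpow_eq_one_iff_exists_map_proj_inv_mulVec_eq (hφ : Function.Bijective φ)
    (hadd : ∀ x y, φ (x + y) = φ x * φ y) {N : ℤ} (hN : N ≠ 0) (P : G) :
    P ^ N = 1 ↔ ∃ v : ι → ℚ, N • v ∈ latticeOfGL (Matrix.GeneralLinearGroup.map (algebraMap ℚ finAdeleQ) γ) ∧
      φ (ComplexTorus.proj Ψ fun i => (((((γ⁻¹ : GL ι ℚ) : Matrix ι ι ℚ) *ᵥ v) i : ℚ) : ℝ)) = P := by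
  constructor
  · exact exists_zsmul_mem_latticeOfGL_and_map_proj_inv_mulVec_eq Ψ φ γ hφ hadd hN
  · rintro ⟨v, hv, rfl⟩
    exact map_proj_inv_mulVec_zpow_eq_one_of_zsmul_mem Ψ φ γ hadd hv

end Parametrisation

/-! ### §3. The spelling for a complex abelian variety: `A[N](ℂ) = u(N⁻¹Λ_γ)` -/

section AbelianVariety

open Literature.AlgebraicGeometry.Motives (AbelianVariety)

variable [Fintype ι] [DecidableEq ι] {A : AbelianVariety ℂ} (φ : ComplexTorus Ψ → A.Points ℂ) (γ : GL ι ℚ)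

/-- **`A[N](ℂ) = u(N⁻¹Λ_γ)`** for a complex abelian variety `A` uniformised (as a group, bijectively) by the torus: `P ∈ A(ℂ)` is
`N`-torsion (`N ≠ 0`) iff `P = u(v)` with `N·v ∈ Λ_γ` — the Siegel-marking analogue of ★
`CMTypeUniformization.mem_torsionPoints_iff_exists_r_eq`. [cite: Shimura1998, §17.1 p. 118, §18.4 (18.4a) (≈ p. 123)]
[cite: Milne2005ShimuraVarieties, §6 Thm. 6.11 p. 74] -/
theorem mem_torsionPoints_iff_exists_map_proj_inv_mulVec_eq (hφ : Function.Bijective φ)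
    (hadd : ∀ x y, φ (x + y) = φ x * φ y) {N : ℤ} (hN : N ≠ 0) (P : A.Points ℂ) :
    P ∈ A.torsionPoints ℂ N ↔ ∃ v : ι → ℚ, N • v ∈ latticeOfGL (Matrix.GeneralLinearGroup.map (algebraMap ℚ finAdeleQ) γ) ∧
      φ (ComplexTorus.proj Ψ fun i => (((((γ⁻¹ : GL ι ℚ) : Matrix ι ι ℚ) *ᵥ v) i : ℚ) : ℝ)) = P := by
  rw [AbelianVariety.mem_torsionPoints_iff]
  exact zpow_eq_one_iff_exists_map_proj_inv_mulVec_eq Ψ φ γ hφ hadd hN P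

/-- **`u(v) ∈ A[N](ℂ)` whenever `N·v ∈ Λ_γ`**. [cite: Shimura1998, §17.1 p. 118] -/
theorem map_proj_inv_mulVec_mem_torsionPoints_of_zsmul_mem (hadd : ∀ x y, φ (x + y) = φ x * φ y) {N : ℤ}
    {v : ι → ℚ} (hv : N • v ∈ latticeOfGL (Matrix.GeneralLinearGroup.map (algebraMap ℚ finAdeleQ) γ)) :
    φ (ComplexTorus.proj Ψ fun i => (((((γ⁻¹ : GL ι ℚ) : Matrix ι ι ℚ) *ᵥ v) i : ℚ) : ℝ)) ∈ A.torsionPoints ℂ N := by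
  rw [AbelianVariety.mem_torsionPoints_iff]
  exact map_proj_inv_mulVec_zpow_eq_one_of_zsmul_mem Ψ φ γ hadd hv

/-- **Every torsion point of `A(ℂ)` is a `u(v)`, `v ∈ ℚ^ι`** (`A(ℂ)_tors = u(ℚ^ι)`). [cite: Shimura1998, §17.1 p. 118, §18.6 Thm. 18.6 pp. 124–125] -/
theorem exists_map_proj_inv_mulVec_eq_of_mem_torsionPoints (hφ : Function.Bijective φ)
    (hadd : ∀ x y, φ (x + y) = φ x * φ y) {N : ℤ} (hN : N ≠ 0) {P : A.Points ℂ} (hP : P ∈ A.torsionPoints ℂ N) :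
    ∃ v : ι → ℚ, N • v ∈ latticeOfGL (Matrix.GeneralLinearGroup.map (algebraMap ℚ finAdeleQ) γ) ∧
      φ (ComplexTorus.proj Ψ fun i => (((((γ⁻¹ : GL ι ℚ) : Matrix ι ι ℚ) *ᵥ v) i : ℚ) : ℝ)) = P :=
  (mem_torsionPoints_iff_exists_map_proj_inv_mulVec_eq Ψ φ γ hφ hadd hN P).1 hP

end AbelianVariety

end Literature.AlgebraicGeometry.ModuliOfAbelianVarieties

end
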